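import Mathlib
import Summits.NavierStokesRegularity.NavierStokesRegularity.Theses.RootDecompLitSlice
import Summits.NavierStokesRegularity.NavierStokesRegularity.Theorems.RootDecompLitSliceGeneralWindowTradeoffStubEnergyDrop
import Summits.NavierStokesRegularity.NavierStokesRegularity.Theorems.RootDecompLitSliceGeneralWindowTradeoffWindowReduction
import Literature.Analysis.FluidPDE.HardyVectorField
import Literature.Analysis.Calculus.HardyExteriorDecay
import Literature.Analysis.FluidPDE.JiaSverak2013Lemma8SliceTools
import HarnessLib

/-!
# Route RootDecompLitSlice — support STg `GeneralWindowTradeoff` ⟨stmt-NavierStokesRegularity-27390⟩: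
  Hardy's inequality on balls for `C¹ ∩ L²` fields of `ℝ³`, and the registered stub (M)
  `stub_windowHardyEnergy` of the skeleton `free_window` (sha256 ab1b91173537) CLOSED BY NAME

`RootDecompLitSliceGeneralWindowTradeoffWindowReduction.lean` (p829316) reduced stub (M) to the
hypothesis

  `hardyBall : ∀ f, ContDiff ℝ 1 f → MemLp f 2 → ∀ x₀ r, 0 < r →
     ∫⁻_{B_r(x₀)} ‖f‖ₑ² ≤ ofReal (4r²) · ∫⁻ ofReal |Df|²_F`.

THIS FILE proves `hardyBall` and hence (M):

* `HardyBall.frobeniusNormSq_add_le_eps` — `|A + B|²_F ≤ (1+ε)|A|²_F + (1+ε⁻¹)|B|²_F`;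
* `HardyBall.lintegral_ball_le_of_cutoff` — for `ψ ∈ C¹_c(ℝ³;ℝ³)` agreeing with `f` on `B_r(x₀)`,
  `∫⁻_{B_r(x₀)} ‖f‖ₑ² ≤ ofReal r² · ofReal (4 ∫ |Dψ|²_F)` (the tree's whole-space vector Hardy
  inequality `Literature.Analysis.FluidPDE.integral_norm_sq_div_norm_sub_sq_le`, constant `4`, and
  `‖y − x₀‖² < r²` on the ball);
* `hardyBall` — the cut-off at infinity: `ψ_k = χ_k(· − x₀) f` with the scaled cut-offs of
  `Literature.Analysis.Calculus.exists_scaled_cutoff` (`χ_k = 1` on `B_k`, `‖Dχ_k‖ ≤ 2C₁/k`), the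
  Leibniz rule `Dψ_k = χ_k Df + Dχ_k ⊗ f`, the `ε`-Young splitting of the Frobenius norm and
  `|Dχ_k ⊗ f|²_F ≤ 3‖Dχ_k‖²|f|²` give
  `∫⁻_{B_r}‖f‖ₑ² ≤ ofReal (4r²((1+η)∫|Df|²_F + (1+η⁻¹)(12C₁²/k²)∫|f|²))` for all `η > 0`, `k ≥ r`;
  let `k → ∞`, then `η → 0⁺` (the case `∫⁻ ofReal |Df|²_F = ∞` is trivial);
* `stub_windowHardyEnergy` — stub (M) of `free_window`, signature verbatim, `:=
  windowHardyEnergy_of_hardyBall hardyBall`.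

With (S) `stub_energyDrop_le_modulus` (p829238) both registered stubs of `free_window` are now
theorems named as in the skeleton; the skeleton's sorry-free composition `GeneralWindowTradeoff_of`
then yields STg, and ST ⟨31791⟩ follows by `WriterG32.scarModulusTradeoff_of_generalWindow`
(τ = r²) — those two compositions are NOT restated here (the gate closes items by name).

HONEST FRAMING: textbook Hardy/cut-off analysis (Hardy 1920; Leray 1934 (1.14); the cut-off removal
as in Galdi 2011, proof of Thm. II.6.1) closing a registered stub of a SUPPORT item — route-internal
glue below ST; nothing here bears on NS regularity (rung 0). Lands
`--supports stmt-NavierStokesRegularity-27390` (decomp-ns route-writer g36). [folklore]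
-/

set_option linter.dupNamespace false

noncomputable section

open MeasureTheory Set Metric Filter Topology
open scoped ENNReal NNReal
open Literature.Analysis.FluidPDE

namespace Summit.NavierStokesRegularity.NavierStokesRegularity.Theorems.GeneralWindowTradeoff

namespace HardyBall

/-- `ε`-Young splitting of the Frobenius norm: `|A + B|²_F ≤ (1+ε)|A|²_F + (1+ε⁻¹)|B|²_F`.
[folklore] -/
theorem frobeniusNormSq_add_le_eps
    (A B : EuclideanSpace ℝ (Fin 3) →L[ℝ] EuclideanSpace ℝ (Fin 3)) {ε : ℝ} (hε : 0 < ε) :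
    frobeniusNormSq (A + B) ≤ (1 + ε) * frobeniusNormSq A + (1 + ε⁻¹) * frobeniusNormSq B := by
  unfold frobeniusNormSq
  rw [Finset.mul_sum, Finset.mul_sum, ← Finset.sum_add_distrib]
  refine Finset.sum_le_sum fun i _ => ?_
  rw [_root_.add_apply]
  set a := ‖A (stdOrthonormalBasis ℝ (EuclideanSpace ℝ (Fin 3)) i)‖
  set b := ‖B (stdOrthonormalBasis ℝ (EuclideanSpace ℝ (Fin 3)) i)‖
  have h := norm_add_le (A (stdOrthonormalBasis ℝ (EuclideanSpace ℝ (Fin 3)) i))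
    (B (stdOrthonormalBasis ℝ (EuclideanSpace ℝ (Fin 3)) i))
  have h' := pow_le_pow_left₀ (norm_nonneg _) h 2
  exact h'.trans (Literature.Analysis.Calculus.add_sq_le_eps a b hε)

/-- The ball step of Hardy's inequality: if `ψ ∈ C¹_c(ℝ³; ℝ³)` agrees with `f` on `B_r(x₀)`, then
`∫⁻_{B_r(x₀)} ‖f‖ₑ² ≤ ofReal r² · ofReal (4 ∫ |Dψ|²_F)` (`‖y − x₀‖² < r²` on the ball, the centre is a
null set, and the whole-space vector Hardy inequality with constant `4`). [folklore] -/
theorem lintegral_ball_le_of_cutoff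
    (f ψ : EuclideanSpace ℝ (Fin 3) → EuclideanSpace ℝ (Fin 3))
    (hψ : ContDiff ℝ 1 ψ) (hψc : HasCompactSupport ψ)
    (x₀ : EuclideanSpace ℝ (Fin 3)) {r : ℝ}
    (hagree : ∀ y ∈ ball x₀ r, ψ y = f y) :
    ∫⁻ y in ball x₀ r, ‖f y‖ₑ ^ 2 ≤
      ENNReal.ofReal (r ^ 2) * ENNReal.ofReal (4 * ∫ y, frobeniusNormSq (fderiv ℝ ψ y)) := by
  have hH := integral_norm_sq_div_norm_sub_sq_le hψ hψc x₀
  have hHi := integrable_norm_sq_div_norm_sub_sq hψ hψc x₀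
  have hnn : ∀ y, 0 ≤ ‖ψ y‖ ^ 2 / ‖y - x₀‖ ^ 2 := fun y => div_nonneg (sq_nonneg _) (sq_nonneg _)
  -- remove the centre (a null set)
  have hae : (ball x₀ r \ {x₀} : Set (EuclideanSpace ℝ (Fin 3))) =ᵐ[volume] ball x₀ r :=
    sdiff_null_ae_eq_self (measure_singleton x₀)
  rw [← setLIntegral_congr hae]
  -- pointwise bound off the centre
  have hpt : ∀ y ∈ ball x₀ r \ {x₀},
      ‖f y‖ₑ ^ 2 ≤ ENNReal.ofReal (r ^ 2) * ENNReal.ofReal (‖ψ y‖ ^ 2 / ‖y - x₀‖ ^ 2) := by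
    intro y hy
    have hyb : y ∈ ball x₀ r := hy.1
    have hyne : y ≠ x₀ := hy.2
    have hdist : ‖y - x₀‖ < r := by rwa [mem_ball, dist_eq_norm] at hyb
    have hpos : 0 < ‖y - x₀‖ := norm_pos_iff.2 (sub_ne_zero.2 hyne)
    have hsq : ‖y - x₀‖ ^ 2 ≤ r ^ 2 := pow_le_pow_left₀ (norm_nonneg _) hdist.le 2
    have hpos2 : 0 < ‖y - x₀‖ ^ 2 := pow_pos hpos 2
    rw [hagree y hyb]
    have hreal : ‖f y‖ ^ 2 ≤ r ^ 2 * (‖f y‖ ^ 2 / ‖y - x₀‖ ^ 2) := by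
      rw [mul_comm, div_mul_eq_mul_div, le_div_iff₀ hpos2]
      exact mul_le_mul_of_nonneg_left hsq (sq_nonneg _)
    calc ‖f y‖ₑ ^ 2 = ENNReal.ofReal (‖f y‖ ^ 2) := by
          rw [← ofReal_norm, ← ENNReal.ofReal_pow (norm_nonneg _)]
      _ ≤ ENNReal.ofReal (r ^ 2 * (‖f y‖ ^ 2 / ‖y - x₀‖ ^ 2)) := ENNReal.ofReal_le_ofReal hreal
      _ = ENNReal.ofReal (r ^ 2) * ENNReal.ofReal (‖f y‖ ^ 2 / ‖y - x₀‖ ^ 2) :=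
          ENNReal.ofReal_mul (sq_nonneg _)
  calc ∫⁻ y in ball x₀ r \ {x₀}, ‖f y‖ₑ ^ 2
      ≤ ∫⁻ y in ball x₀ r \ {x₀},
          ENNReal.ofReal (r ^ 2) * ENNReal.ofReal (‖ψ y‖ ^ 2 / ‖y - x₀‖ ^ 2) :=
        setLIntegral_mono' (measurableSet_ball.diff (measurableSet_singleton x₀)) hpt
    _ = ENNReal.ofReal (r ^ 2) *
          ∫⁻ y in ball x₀ r \ {x₀}, ENNReal.ofReal (‖ψ y‖ ^ 2 / ‖y - x₀‖ ^ 2) :=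
        lintegral_const_mul' _ _ ENNReal.ofReal_ne_top
    _ ≤ ENNReal.ofReal (r ^ 2) * ∫⁻ y, ENNReal.ofReal (‖ψ y‖ ^ 2 / ‖y - x₀‖ ^ 2) :=
        mul_le_mul_of_nonneg_left (setLIntegral_le_lintegral _ _) (by simp)
    _ = ENNReal.ofReal (r ^ 2) * ENNReal.ofReal (∫ y, ‖ψ y‖ ^ 2 / ‖y - x₀‖ ^ 2) := by
        rw [ofReal_integral_eq_lintegral_ofReal hHi (ae_of_all _ hnn)]
    _ ≤ ENNReal.ofReal (r ^ 2) * ENNReal.ofReal (4 * ∫ y, frobeniusNormSq (fderiv ℝ ψ y)) := by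
        gcongr

/-- Pointwise Leibniz bound for a cut-off product: if `0 ≤ c ≤ 1` and `‖ℓ‖ ≤ K`, then
`|c A + ℓ ⊗ z|²_F ≤ (1+η)|A|²_F + (1+η⁻¹)(3K²)|z|²`. [folklore] -/
theorem frobeniusNormSq_leibniz_le {c K η : ℝ} (hc0 : 0 ≤ c) (hc1 : c ≤ 1) (hη : 0 < η)
    (A : EuclideanSpace ℝ (Fin 3) →L[ℝ] EuclideanSpace ℝ (Fin 3))
    (ℓ : EuclideanSpace ℝ (Fin 3) →L[ℝ] ℝ) (hℓ : ‖ℓ‖ ≤ K) (z : EuclideanSpace ℝ (Fin 3)) :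
    frobeniusNormSq (c • A + ℓ.smulRight z) ≤
      (1 + η) * frobeniusNormSq A + (1 + η⁻¹) * (3 * K ^ 2 * ‖z‖ ^ 2) := by
  have h1 := frobeniusNormSq_add_le_eps (c • A) (ℓ.smulRight z) hη
  rw [frobeniusNormSq_smul_eq] at h1
  have hA := frobeniusNormSq_nonneg A
  have hc2 : c ^ 2 * frobeniusNormSq A ≤ frobeniusNormSq A := by
    have : c ^ 2 ≤ 1 := by nlinarith
    nlinarith
  have hK : 0 ≤ K := (norm_nonneg ℓ).trans hℓ
  have h2 : frobeniusNormSq (ℓ.smulRight z) ≤ 3 * K ^ 2 * ‖z‖ ^ 2 := by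
    refine (frobeniusNormSq_smulRight_le_three ℓ z).trans ?_
    have : ‖ℓ‖ ^ 2 ≤ K ^ 2 := pow_le_pow_left₀ (norm_nonneg _) hℓ 2
    nlinarith [sq_nonneg ‖z‖]
  have hη1 : 0 ≤ 1 + η := by linarith
  have hη2 : 0 ≤ 1 + η⁻¹ := by positivity
  calc frobeniusNormSq (c • A + ℓ.smulRight z)
      ≤ (1 + η) * (c ^ 2 * frobeniusNormSq A) + (1 + η⁻¹) * frobeniusNormSq (ℓ.smulRight z) := h1
    _ ≤ (1 + η) * frobeniusNormSq A + (1 + η⁻¹) * (3 * K ^ 2 * ‖z‖ ^ 2) := by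
        gcongr

end HardyBall

open HardyBall in
/-- **Hardy's inequality on balls for `C¹ ∩ L²` fields of `ℝ³`** (constant `4`, `[0, ∞]`-valued;
trivial when `∇f ∉ L²`): `∫⁻_{B_r(x₀)} ‖f‖ₑ² ≤ ofReal (4r²) · ∫⁻ ofReal |Df|²_F`. Cut-off at infinity
from the tree's `C¹_c` whole-space inequality (Hardy 1920; Leray 1934 (1.14); Galdi 2011,
Thm. II.6.1 for the truncation). [folklore] -/
theorem hardyBall (f : EuclideanSpace ℝ (Fin 3) → EuclideanSpace ℝ (Fin 3))
    (hf : ContDiff ℝ 1 f) (hf2 : MemLp f 2 volume) (x₀ : EuclideanSpace ℝ (Fin 3)) (r : ℝ)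
    (hr : 0 < r) :
    ∫⁻ y in ball x₀ r, ‖f y‖ₑ ^ 2 ≤
      ENNReal.ofReal (4 * r ^ 2) * ∫⁻ y, ENNReal.ofReal (frobeniusNormSq (fderiv ℝ f y)) := by
  set J : ℝ≥0∞ := ∫⁻ y, ENNReal.ofReal (frobeniusNormSq (fderiv ℝ f y)) with hJdef
  have h4r : 0 < 4 * r ^ 2 := by positivity
  by_cases hJtop : J = ⊤
  · rw [hJtop, ENNReal.mul_top (ENNReal.ofReal_pos.2 h4r).ne']
    exact le_top
  -- `|Df|²_F` is integrable, `J = ofReal Jr`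
  have hFc : Continuous fun y => frobeniusNormSq (fderiv ℝ f y) := by
    simp only [frobeniusNormSq]
    exact continuous_finsetSum _ fun i _ =>
      (((hf.continuous_fderiv one_ne_zero).clm_apply continuous_const).norm.pow 2)
  have hFnn : ∀ y, 0 ≤ frobeniusNormSq (fderiv ℝ f y) := fun y => frobeniusNormSq_nonneg _
  have hFi : Integrable fun y => frobeniusNormSq (fderiv ℝ f y) := by
    refine ⟨hFc.aestronglyMeasurable, ?_⟩
    rw [hasFiniteIntegral_iff_ofReal (ae_of_all _ hFnn)]
    exact lt_top_iff_ne_top.2 hJtop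
  set Jr : ℝ := ∫ y, frobeniusNormSq (fderiv ℝ f y) with hJrdef
  have hJr0 : 0 ≤ Jr := integral_nonneg hFnn
  have hJeq : J = ENNReal.ofReal Jr := by
    rw [hJrdef, ofReal_integral_eq_lintegral_ofReal hFi (ae_of_all _ hFnn)]
  -- the `L²` mass
  set M : ℝ := ∫ y, ‖f y‖ ^ 2 with hMdef
  have hM0 : 0 ≤ M := integral_nonneg fun _ => sq_nonneg _
  have hMi : Integrable fun y => ‖f y‖ ^ 2 := (memLp_two_iff_integrable_sq_norm hf2.1).1 hf2
  -- the left-hand side is finite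
  set L : ℝ≥0∞ := ∫⁻ y in ball x₀ r, ‖f y‖ₑ ^ 2 with hLdef
  have hLfin : L ≠ ⊤ := by
    refine ne_top_of_le_ne_top (b := ∫⁻ y, ‖f y‖ₑ ^ 2) ?_ (setLIntegral_le_lintegral _ _)
    rw [EnergyDrop.lintegral_enorm_sq_eq_ofReal_integral f hf2]
    exact ENNReal.ofReal_ne_top
  -- the cut-offs
  obtain ⟨χ, C₁, hC₁, hχ⟩ :=
    Literature.Analysis.Calculus.exists_scaled_cutoff (E := EuclideanSpace ℝ (Fin 3))
  have hfd : ∀ y, HasFDerivAt f (fderiv ℝ f y) y := fun y =>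
    ((hf.differentiable one_ne_zero) y).hasFDerivAt
  -- KEY: for `η > 0` and `k ≥ r`, `L.toReal ≤ 4r²((1+η)Jr + (1+η⁻¹)(12C₁²/k²)M)`
  have key : ∀ η : ℝ, 0 < η → ∀ k : ℝ, r ≤ k →
      L.toReal ≤ 4 * r ^ 2 * ((1 + η) * Jr + (1 + η⁻¹) * (12 * C₁ ^ 2 / k ^ 2) * M) := by
    intro η hη k hk
    have hk0 : 0 < k := hr.trans_le hk
    obtain ⟨hcC1, hc0, hc1, hcone, hczero, hcDin, hcDout⟩ := hχ k hk0
    -- the truncated field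
    set c : EuclideanSpace ℝ (Fin 3) → ℝ := fun y => χ k (y - x₀) with hcdef
    set ψ : EuclideanSpace ℝ (Fin 3) → EuclideanSpace ℝ (Fin 3) := fun y => c y • f y with hψdef
    have hcC1' : ContDiff ℝ 1 c := hcC1.comp (contDiff_id.sub contDiff_const)
    have hψC1 : ContDiff ℝ 1 ψ := hcC1'.smul hf
    have hψc : HasCompactSupport ψ := by
      refine HasCompactSupport.intro (isCompact_closedBall x₀ (2 * k)) fun y hy => ?_
      have hy' : 2 * k ≤ ‖y - x₀‖ := by
        rw [mem_closedBall, dist_eq_norm] at hy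
        exact (not_le.1 hy).le
      simp [hψdef, hcdef, hczero _ hy']
    have hagree : ∀ y ∈ ball x₀ r, ψ y = f y := by
      intro y hy
      have hy' : ‖y - x₀‖ ≤ k := by
        rw [mem_ball, dist_eq_norm] at hy
        exact hy.le.trans hk
      simp [hψdef, hcdef, hcone _ hy']
    -- derivative of the cut-off and its bound `‖Dc‖ ≤ 2C₁/k`
    have hcd : ∀ y, HasFDerivAt c (fderiv ℝ (χ k) (y - x₀)) y := by
      intro y
      have h1 : HasFDerivAt (fun y : EuclideanSpace ℝ (Fin 3) => y - x₀)
          (ContinuousLinearMap.id ℝ (EuclideanSpace ℝ (Fin 3))) y :=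
        (hasFDerivAt_id y).sub_const x₀
      have h2 : HasFDerivAt (χ k) (fderiv ℝ (χ k) (y - x₀)) (y - x₀) :=
        ((hcC1.differentiable one_ne_zero) _).hasFDerivAt
      have := h2.comp y h1
      rwa [ContinuousLinearMap.comp_id] at this
    have hDc : ∀ y, ‖fderiv ℝ (χ k) (y - x₀)‖ ≤ 2 * C₁ / k := by
      intro y
      rcases lt_or_ge ‖y - x₀‖ k with hlt | hge
      · rw [hcDin _ hlt, norm_zero]
        positivity
      · exact (hcDout _ hge).trans (div_le_div_of_nonneg_left (by positivity) hk0 hge)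
    -- the Leibniz rule and the pointwise gradient bound
    have hψd : ∀ y, HasFDerivAt ψ
        (c y • fderiv ℝ f y + (fderiv ℝ (χ k) (y - x₀)).smulRight (f y)) y :=
      fun y => (hcd y).smul (hfd y)
    have hpt : ∀ y, frobeniusNormSq (fderiv ℝ ψ y) ≤
        (1 + η) * frobeniusNormSq (fderiv ℝ f y) +
          (1 + η⁻¹) * (3 * (2 * C₁ / k) ^ 2 * ‖f y‖ ^ 2) := by
      intro y
      rw [(hψd y).fderiv]
      exact frobeniusNormSq_leibniz_le (hc0 _) (hc1 _) hη _ _ (hDc y) _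
    -- integrate
    have hψFc : Continuous fun y => frobeniusNormSq (fderiv ℝ ψ y) := by
      simp only [frobeniusNormSq]
      exact continuous_finsetSum _ fun i _ =>
        (((hψC1.continuous_fderiv one_ne_zero).clm_apply continuous_const).norm.pow 2)
    have hψFi : Integrable fun y => frobeniusNormSq (fderiv ℝ ψ y) :=
      hψFc.integrable_of_hasCompactSupport (hasCompactSupport_frobeniusNormSq_fderiv hψc)
    have hRi : Integrable fun y => (1 + η) * frobeniusNormSq (fderiv ℝ f y) +
        (1 + η⁻¹) * (3 * (2 * C₁ / k) ^ 2 * ‖f y‖ ^ 2) :=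
      (hFi.const_mul _).add ((hMi.const_mul _).const_mul _)
    have hint : ∫ y, frobeniusNormSq (fderiv ℝ ψ y) ≤
        (1 + η) * Jr + (1 + η⁻¹) * (12 * C₁ ^ 2 / k ^ 2) * M := by
      refine (integral_mono hψFi hRi hpt).trans (le_of_eq ?_)
      rw [integral_add (hFi.const_mul _) ((hMi.const_mul _).const_mul _), integral_const_mul,
        integral_const_mul, integral_const_mul, hJrdef, hMdef]
      have hk' : k ≠ 0 := hk0.ne'
      field_simp
      ring
    -- combine with the ball step
    have hball := lintegral_ball_le_of_cutoff f ψ hψC1 hψc x₀ hagree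
    have hY0 : 0 ≤ (1 + η) * Jr + (1 + η⁻¹) * (12 * C₁ ^ 2 / k ^ 2) * M := by positivity
    have hL : L ≤ ENNReal.ofReal
        (4 * r ^ 2 * ((1 + η) * Jr + (1 + η⁻¹) * (12 * C₁ ^ 2 / k ^ 2) * M)) := by
      refine hball.trans ?_
      rw [← ENNReal.ofReal_mul (sq_nonneg _)]
      refine ENNReal.ofReal_le_ofReal ?_
      have hr2 : 0 ≤ r ^ 2 := sq_nonneg _
      nlinarith [mul_le_mul_of_nonneg_left hint hr2]
    exact ENNReal.toReal_le_of_le_ofReal (by positivity) hL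
  -- let `k → ∞`: `L.toReal ≤ 4r²(1+η)Jr`
  have step : ∀ η : ℝ, 0 < η → L.toReal ≤ 4 * r ^ 2 * ((1 + η) * Jr) := by
    intro η hη
    have hlim : Tendsto (fun k : ℝ =>
        4 * r ^ 2 * ((1 + η) * Jr + (1 + η⁻¹) * (12 * C₁ ^ 2 / k ^ 2) * M)) atTop
        (𝓝 (4 * r ^ 2 * ((1 + η) * Jr + (1 + η⁻¹) * 0 * M))) := by
      have h0 : Tendsto (fun k : ℝ => 12 * C₁ ^ 2 / k ^ 2) atTop (𝓝 0) :=
        tendsto_const_nhds.div_atTop (tendsto_pow_atTop two_ne_zero)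
      exact ((((h0.const_mul (1 + η⁻¹)).mul_const M).const_add ((1 + η) * Jr)).const_mul
        (4 * r ^ 2))
    have hev : ∀ᶠ k : ℝ in atTop,
        L.toReal ≤ 4 * r ^ 2 * ((1 + η) * Jr + (1 + η⁻¹) * (12 * C₁ ^ 2 / k ^ 2) * M) :=
      (eventually_ge_atTop r).mono fun k hk => key η hη k hk
    have := ge_of_tendsto hlim hev
    simpa using this
  -- let `η → 0⁺`: `L.toReal ≤ 4r²Jr`
  have hfinal : L.toReal ≤ 4 * r ^ 2 * Jr := by
    have hcont : Continuous fun η : ℝ => 4 * r ^ 2 * ((1 + η) * Jr) := by fun_prop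
    have hlim : Tendsto (fun η : ℝ => 4 * r ^ 2 * ((1 + η) * Jr)) (𝓝[>] 0)
        (𝓝 (4 * r ^ 2 * ((1 + 0) * Jr))) :=
      (hcont.tendsto 0).mono_left nhdsWithin_le_nhds
    have hev : ∀ᶠ η : ℝ in 𝓝[>] 0, L.toReal ≤ 4 * r ^ 2 * ((1 + η) * Jr) :=
      eventually_nhdsWithin_of_forall fun η hη => step η hη
    have := ge_of_tendsto hlim hev
    simpa using this
  -- back to `[0, ∞]`
  calc L = ENNReal.ofReal L.toReal := (ENNReal.ofReal_toReal hLfin).symm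
    _ ≤ ENNReal.ofReal (4 * r ^ 2 * Jr) := ENNReal.ofReal_le_ofReal hfinal
    _ = ENNReal.ofReal (4 * r ^ 2) * J := by rw [hJeq, ENNReal.ofReal_mul h4r.le]

/-- **Stub (M) `stub_windowHardyEnergy` of the skeleton `free_window`** (support STg
`GeneralWindowTradeoff` ⟨stmt-NavierStokesRegularity-27390⟩, skeleton sha256 ab1b91173537), signature
verbatim: on the classical Leray–Hopf frame, a window bound `∫|u(t) − u(T)|² ≤ H` on `[T−τ, T)` gives
`∫_{B_r(x₀)}|u(T)|² ≤ 2H + (4r²/(ντ))·(‖u(T−τ)‖₂² − ‖u(T)‖₂²)`. Proof: the landed reduction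
`windowHardyEnergy_of_hardyBall` (p829316) applied to `hardyBall`. [folklore] -/
theorem stub_windowHardyEnergy :
    ∀ (ν T : ℝ), 0 < ν → 0 < T →
    ∀ (u : ℝ → EuclideanSpace ℝ (Fin 3) → EuclideanSpace ℝ (Fin 3))
      (p : ℝ → EuclideanSpace ℝ (Fin 3) → ℝ),
      Literature.Analysis.FluidPDE.IsClassicalNSSolutionOn (Set.Ico 0 T) ν 0 u p →
      Literature.Analysis.FluidPDE.IsLerayHopfOn T ν 0 (u 0) u →
      Literature.Analysis.FluidPDE.HasRapidSpatialDecay (u 0) →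
      ∀ (x₀ : EuclideanSpace ℝ (Fin 3)) (r τ H : ℝ), 0 < r → 0 < τ → τ < T → 0 ≤ H →
        (∀ t ∈ Set.Ico (T - τ) T, ∫⁻ x, ‖u t x - u T x‖ₑ ^ 2 ≤ ENNReal.ofReal H) →
        ∫ x in Metric.ball x₀ r, ‖u T x‖ ^ 2 ≤
          2 * H + 4 * (r ^ 2 / (ν * τ)) * ((∫ x, ‖u (T - τ) x‖ ^ 2) - ∫ x, ‖u T x‖ ^ 2) :=
  windowHardyEnergy_of_hardyBall hardyBall

end Summit.NavierStokesRegularity.NavierStokesRegularity.Theorems.GeneralWindowTradeoff
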